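import Literature.NumberTheory.EllipticCurves.DeShalit1987.KatzMeasureTwistedLines
import HarnessLib

/-!
# Lines through the origin in the two-variable receptacle `𝒪_{ℂ_p}⟦T₁⟧⟦T₂⟧`: substitution of a
# formal curve `(T₁, T₂) = (a₁(T), a₂(T))`, its coefficients, its reduction modulo `𝔪`, and its values
# (all PROVED; no named fact)

de Shalit 1987, II.4.17 (51)–(54) (p. 77–78): the two-variable function
`L_{p,𝔣}(χ; s₁, s₂) = L_{p,𝔣}(χ κ₁^{−s₁} κ₂^{−s₂})`, i.e. `G(χ; T₁, T₂)` with `1 + T_i ↔ γ_i`, restricts to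
a ONE-variable function along every `ℤ_p`-LINE `Gal(K_∞/K)` of the `ℤ_p²`-tower `Gal(K̃_∞/K)` (52)–(53):
if `γ` generates the line and `γ ≡ γ₁^{c₁} γ₂^{c₂}` (`(c₁, c₂) ∈ ℤ_p²` the coordinates of the line),
a character `ρ` of the line with `ρ(γ) = 1 + x` has `ρ(γ_i) = (1 + x)^{c_i}`, so the restriction is the
substitution `T_i ↦ (1 + T)^{c_i} − 1` — a formal CURVE THROUGH THE ORIGIN of the bidisc. This file
types that substitution on the tree's integral receptacle `PowerSeries (PowerSeries R)` (outer `T₁`,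
inner `T₂`; companions: the PARALLEL line `T₁ = c` of `Rubin1991/TwoVariableCMLines.lean`
(`IntSeries.lineSubst`) and the unit twist / transposition of `DeShalit1987/KatzMeasureTwistedLines.lean`)
for an arbitrary pair `(a₁, a₂)` of one-variable series WITHOUT constant term, and proves:

* §1 (generic commutative ring `R`) `IntSeries.curveSubst a₁ a₂ G ∈ R⟦T⟧`, coefficientwise the
  FINITE sum `[T^n] = ∑_{i,j ≤ n} [T₁^i T₂^j]G · [T^n](a₁^i a₂^j)` (terms with `i + j > n` vanish:
  `coeff_pow_mul_pow_eq_zero_of_lt`); the two axes as degenerate curves (`curveSubst_zero_X = constantCoeff`,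
  the inner axis of `IsKatzMeasure₂.isKatzBranch_constantCoeff`; `curveSubst_X_zero = map constantCoeff`,
  the outer axis); compatibility with a change of coefficients `map_curveSubst` (in particular with
  reduction modulo an ideal); and, over a LOCAL ring, the order inequality of the restriction in unit
  currency: **a unit coefficient of the restriction in degree `n` forces a unit coefficient
  `[T₁^i T₂^j]G` with `i + j ≤ n`** (`exists_isUnit_coeff_coeff_of_isUnit_coeff_curveSubst`) — i.e.
  `ord(Ḡ ∘ curve) ≥ ord Ḡ =: m₀` for the reductions: the inequality "`λ` of every line `≥ m₀`" on which
  the falsifier of route `CycTangentCM`'s crux `CycTangentBound` rests (Cuoco–Monsky: equality off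
  finitely many exceptional directions; only the trivial inequality is proved here), and, read
  contrapositively, "unit content on ONE line through the origin ⟹ two-variable unit content"
  (`exists_isUnit_coeff_coeff_of_hasUnitContent_curveSubst`; the converse fails, `NoAxisTransport.lean`).
* §2 (`R = 𝒪_{ℂ_p}`) values: one-variable evaluation is multiplicative on the open disc
  (`HasValueAt.mul`, `HasValueAt.pow`, Cauchy product of absolutely convergent series), and
  **`curveSubst a₁ a₂ G` has value `v` at `x` iff `G` has value `v` at `(a₁(x), a₂(x))`**
  (`hasValueAt_curveSubst_iff`, `‖x‖ < 1`; absolute convergence of the triple family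
  `[T₁^iT₂^j]G · [T^n](a₁^ia₂^j) · x^n`, bounded by `s^i s^j s^n` with `s = ‖x‖^{1/2}` on its support
  `i + j ≤ n`, and fibrewise summation both ways).
The monomial curves `a_i = (1+T)^{c_i} − 1` with `p`-adic exponents, their values `(1+x)^{c_i} − 1`
and the frame corollary (`IsKatzMeasure₂` ⟹ `IsKatzBranch` along a sub-`ℤ_p`-line) are in the sequel
`KatzMeasureMonomialLinesPAdic.lean` (the avatar identity `ρ(γ_i) = ρ(γ)^{c_i}` lives there).

References: E. de Shalit, *Iwasawa theory of elliptic curves with complex multiplication* (1987),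
II.4.17 (51)–(54) [deShalit1987]; N. Koblitz, *p-adic Numbers, p-adic Analysis, and Zeta-Functions*,
GTM 58 (1984), Ch. IV §1 (power series on `p`-adic discs) [Koblitz1984]; route `CycTangentCM`.
-/

noncomputable section

open Filter Topology Finset
open Literature.NumberTheory.EllipticCurves.GreenbergVatsal2000

namespace Literature.NumberTheory.EllipticCurves

namespace IntSeries

/-! ### §1. The substitution of a formal curve through the origin (generic coefficients) -/

section Formal

variable {R : Type*} [CommRing R]

/-- **The restriction of `G ∈ R⟦T₁⟧⟦T₂⟧` to the formal curve `(T₁, T₂) = (a₁(T), a₂(T))`**: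
`G(a₁(T), a₂(T)) ∈ R⟦T⟧`, defined coefficientwise by the finite sums
`[T^n] = ∑_{i ≤ n} ∑_{j ≤ n} [T₁^i T₂^j]G · [T^n](a₁^i a₂^j)` — the genuine substitution when `a₁, a₂`
have no constant term (then `[T^n](a₁^ia₂^j) = 0` for `i + j > n`; for general `a₁, a₂` the formula is a
truncation with no meaning). de Shalit's one-variable restriction (52)–(53) of the two-variable
`G(χ; T₁, T₂)` along a `ℤ_p`-line is the case `a_i = (1+T)^{c_i} − 1`.
[cite: deShalit1987, II.4.17 (51)–(54) (p. 77–78)] -/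
def curveSubst (a₁ a₂ : PowerSeries R) (G : PowerSeries (PowerSeries R)) : PowerSeries R :=
  PowerSeries.mk fun n ↦ ∑ i ∈ range (n + 1), ∑ j ∈ range (n + 1),
    PowerSeries.coeff j (PowerSeries.coeff i G) * PowerSeries.coeff n (a₁ ^ i * a₂ ^ j)

variable (a₁ a₂ : PowerSeries R) (G : PowerSeries (PowerSeries R))

/-- The coefficients of the restriction. [cite: deShalit1987, II.4.17 (51)–(54) (p. 77–78)] -/
theorem coeff_curveSubst (n : ℕ) :
    PowerSeries.coeff n (curveSubst a₁ a₂ G) = ∑ i ∈ range (n + 1), ∑ j ∈ range (n + 1),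
      PowerSeries.coeff j (PowerSeries.coeff i G) * PowerSeries.coeff n (a₁ ^ i * a₂ ^ j) := by
  rw [curveSubst, PowerSeries.coeff_mk]

/-- The restriction of `0` is `0`. [cite: deShalit1987, II.4.17 (51)–(54) (p. 77–78)] -/
@[simp] theorem curveSubst_zero_right : curveSubst a₁ a₂ (0 : PowerSeries (PowerSeries R)) = 0 := by
  ext n
  simp [coeff_curveSubst]

variable {a₁ a₂}

/-- For curves through the origin, `[T^n](a₁^i a₂^j) = 0` whenever `n < i + j` (`T^{i+j} ∣ a₁^i a₂^j`).
[cite: deShalit1987, II.4.17 (51)–(54) (p. 77–78)] -/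
theorem coeff_pow_mul_pow_eq_zero_of_lt (ha₁ : PowerSeries.constantCoeff a₁ = 0)
    (ha₂ : PowerSeries.constantCoeff a₂ = 0) {i j n : ℕ} (h : n < i + j) :
    PowerSeries.coeff n (a₁ ^ i * a₂ ^ j) = 0 := by
  have h1 : (PowerSeries.X : PowerSeries R) ^ i ∣ a₁ ^ i :=
    pow_dvd_pow_of_dvd (PowerSeries.X_dvd_iff.mpr ha₁) i
  have h2 : (PowerSeries.X : PowerSeries R) ^ j ∣ a₂ ^ j :=
    pow_dvd_pow_of_dvd (PowerSeries.X_dvd_iff.mpr ha₂) j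
  have h12 : (PowerSeries.X : PowerSeries R) ^ (i + j) ∣ a₁ ^ i * a₂ ^ j := by
    rw [pow_add]
    exact mul_dvd_mul h1 h2
  exact PowerSeries.X_pow_dvd_iff.mp h12 n h

/-- **The inner axis as a degenerate curve**: `curveSubst 0 T G = G(0, T) = constantCoeff G` (the line
`T₁ = 0` of `IsKatzMeasure₂.isKatzBranch_constantCoeff`, coordinates `(c₁, c₂) = (0, 1)`).
[cite: deShalit1987, II.4.17 (51)–(54) (p. 77–78)] -/
theorem curveSubst_zero_X : curveSubst 0 PowerSeries.X G = PowerSeries.constantCoeff G := by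
  ext n
  rw [coeff_curveSubst, sum_eq_single 0]
  · rw [sum_eq_single n]
    · simp [PowerSeries.coeff_X_pow]
    · intro j _ hj
      rw [pow_zero, one_mul, PowerSeries.coeff_X_pow, if_neg hj.symm, mul_zero]
    · simp
  · intro i _ hi
    exact sum_eq_zero fun j _ ↦ by rw [zero_pow hi, zero_mul, map_zero, mul_zero]
  · simp

/-- **The outer axis as a degenerate curve**: `curveSubst T 0 G = G(T, 0) = G.map constantCoeff` (the line
`T₂ = 0`, coordinates `(1, 0)`; `constantCoeff Gᵗ` of `KatzMeasureTwistedLines`).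
[cite: deShalit1987, II.4.17 (51)–(54) (p. 77–78)] -/
theorem curveSubst_X_zero :
    curveSubst PowerSeries.X 0 G = PowerSeries.map PowerSeries.constantCoeff G := by
  ext n
  rw [coeff_curveSubst, sum_eq_single n]
  · rw [sum_eq_single 0]
    · simp [PowerSeries.coeff_X_pow]
    · intro j _ hj
      rw [zero_pow hj, mul_zero, map_zero, mul_zero]
    · simp
  · intro i _ hi
    refine sum_eq_zero fun j _ ↦ ?_
    by_cases hj : j = 0
    · subst hj
      rw [pow_zero, mul_one, PowerSeries.coeff_X_pow, if_neg hi.symm, mul_zero]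
    · rw [zero_pow hj, mul_zero, map_zero, mul_zero]
  · simp

/-- **Change of coefficients**: the restriction commutes with `PowerSeries.map` (in particular with
reduction modulo an ideal of `R`). [cite: deShalit1987, II.4.17 (51)–(54) (p. 77–78)] -/
theorem map_curveSubst {S : Type*} [CommRing S] (φ : R →+* S) :
    PowerSeries.map φ (curveSubst a₁ a₂ G) =
      curveSubst (PowerSeries.map φ a₁) (PowerSeries.map φ a₂) (PowerSeries.map (PowerSeries.map φ) G) := by
  ext n
  rw [PowerSeries.coeff_map, coeff_curveSubst, coeff_curveSubst, map_sum]
  refine sum_congr rfl fun i _ ↦ ?_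
  rw [map_sum]
  refine sum_congr rfl fun j _ ↦ ?_
  rw [map_mul, PowerSeries.coeff_map, PowerSeries.coeff_map, ← map_pow (PowerSeries.map φ) a₁ i,
    ← map_pow (PowerSeries.map φ) a₂ j, ← map_mul (PowerSeries.map φ) (a₁ ^ i) (a₂ ^ j),
    PowerSeries.coeff_map]

/-- **The order inequality of a line, in unit currency (local coefficient ring).** If the restriction
of `G` to a curve through the origin has a UNIT coefficient in degree `n`, then `G` has a unit
coefficient `[T₁^i T₂^j]G` of total degree `i + j ≤ n`: every term of `[T^n]` is `[T₁^iT₂^j]G · [T^n](a₁^ia₂^j)`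
with either `i + j ≤ n` or `[T^n](a₁^ia₂^j) = 0`, so if all `[T₁^iT₂^j]G`, `i + j ≤ n`, lay in the maximal
ideal so would `[T^n]`. Equivalently `ord(Ḡ ∘ curve) ≥ ord Ḡ` for the reductions — "`λ` of a line is at
least `m₀`", the inequality behind the falsifier of route `CycTangentCM`'s crux (Cuoco–Monsky give
equality off finitely many directions; not proved here). [cite: deShalit1987, II.4.17 (51)–(54) (p. 77–78)] -/
theorem exists_isUnit_coeff_coeff_of_isUnit_coeff_curveSubst [IsLocalRing R]
    (ha₁ : PowerSeries.constantCoeff a₁ = 0) (ha₂ : PowerSeries.constantCoeff a₂ = 0) {n : ℕ}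
    (h : IsUnit (PowerSeries.coeff n (curveSubst a₁ a₂ G))) :
    ∃ i j : ℕ, i + j ≤ n ∧ IsUnit (PowerSeries.coeff j (PowerSeries.coeff i G)) := by
  by_contra hne
  push Not at hne
  have hmem : PowerSeries.coeff n (curveSubst a₁ a₂ G) ∈ IsLocalRing.maximalIdeal R := by
    rw [coeff_curveSubst]
    refine Ideal.sum_mem _ fun i _ ↦ Ideal.sum_mem _ fun j _ ↦ ?_
    by_cases hij : i + j ≤ n
    · exact Ideal.mul_mem_right _ _ ((IsLocalRing.mem_maximalIdeal _).mpr (hne i j hij))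
    · rw [coeff_pow_mul_pow_eq_zero_of_lt ha₁ ha₂ (not_le.mp hij), mul_zero]
      exact zero_mem _
  exact (IsLocalRing.mem_maximalIdeal _).mp hmem h

/-- **Unit content on one line through the origin gives two-variable unit content** (local
coefficient ring): if `G(a₁(T), a₂(T))` has a unit coefficient then so has `G`. The converse fails
(`G = T₁` on the inner axis: `Theorems/MuZeroCMCurves/Negative/NoAxisTransport.lean`).
[cite: deShalit1987, II.4.17 (51)–(54) (p. 77–78)] -/
theorem exists_isUnit_coeff_coeff_of_hasUnitContent_curveSubst [IsLocalRing R]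
    (ha₁ : PowerSeries.constantCoeff a₁ = 0) (ha₂ : PowerSeries.constantCoeff a₂ = 0)
    (h : HasUnitContent (curveSubst a₁ a₂ G)) :
    ∃ i j : ℕ, IsUnit (PowerSeries.coeff j (PowerSeries.coeff i G)) := by
  obtain ⟨n, hn⟩ := h
  obtain ⟨i, j, -, hij⟩ := exists_isUnit_coeff_coeff_of_isUnit_coeff_curveSubst G ha₁ ha₂ hn
  exact ⟨i, j, hij⟩

/-- Residue form: if `G ≡ 0` modulo the maximal ideal then so is every restriction to a curve.
[cite: deShalit1987, II.4.17 (51)–(54) (p. 77–78)] -/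
theorem map_residue_curveSubst_eq_zero [IsLocalRing R]
    (hG : PowerSeries.map (PowerSeries.map (IsLocalRing.residue R)) G = 0) :
    PowerSeries.map (IsLocalRing.residue R) (curveSubst a₁ a₂ G) = 0 := by
  rw [map_curveSubst, hG, curveSubst_zero_right]

end Formal

/-! ### §2. Values of the restriction (`R = 𝒪_{ℂ_p}`) -/

section Values

variable {p : ℕ} [Fact p.Prime]

/-- The terms `[T^k]Q · x^k` of a one-variable integral series are dominated by `‖x‖^k`. [cite: Koblitz1984, Ch. IV §1] -/
theorem norm_coeff_mul_pow_le_one (Q : PowerSeries (PadicComplexInt p)) (x : ℂ_[p]) (k : ℕ) :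
    ‖((PowerSeries.coeff k Q : PadicComplexInt p) : ℂ_[p]) * x ^ k‖ ≤ ‖x‖ ^ k := by
  rw [norm_mul, norm_pow]
  exact mul_le_of_le_one_left (pow_nonneg (norm_nonneg _) _) (norm_coe_padicComplexInt_le_one _)

/-- On the open disc the terms `[T^k]Q · x^k` are absolutely summable. [cite: Koblitz1984, Ch. IV §1] -/
theorem summable_norm_coeff_mul_pow (Q : PowerSeries (PadicComplexInt p)) {x : ℂ_[p]} (hx : ‖x‖ < 1) :
    Summable fun k : ℕ ↦ ‖((PowerSeries.coeff k Q : PadicComplexInt p) : ℂ_[p]) * x ^ k‖ :=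
  (summable_geometric_of_lt_one (norm_nonneg x) hx).of_nonneg_of_le (fun _ ↦ norm_nonneg _)
    (norm_coeff_mul_pow_le_one Q x)

/-- **Every integral series has a value at every point of the open disc** (the `tsum`).
[cite: deShalit1987, II.4.17 (52) (p. 77)] -/
theorem hasValueAt_tsum (Q : PowerSeries (PadicComplexInt p)) {x : ℂ_[p]} (hx : ‖x‖ < 1) :
    IntSeries.HasValueAt Q x (∑' k : ℕ, ((PowerSeries.coeff k Q : PadicComplexInt p) : ℂ_[p]) * x ^ k) :=
  (summable_norm_coeff_mul_pow Q hx).of_norm.hasSum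

/-- **A series without constant term maps the open disc into itself**: its value at `x` has norm
`≤ ‖x‖`. [cite: Koblitz1984, Ch. IV §1] -/
theorem norm_le_of_hasValueAt_of_constantCoeff_eq_zero {Q : PowerSeries (PadicComplexInt p)}
    (hQ : PowerSeries.constantCoeff Q = 0) {x v : ℂ_[p]} (hx : ‖x‖ < 1)
    (h : IntSeries.HasValueAt Q x v) : ‖v‖ ≤ ‖x‖ := by
  have hs := (summable_norm_coeff_mul_pow Q hx).of_norm
  rw [← h.tsum_eq, hs.tsum_eq_zero_add, PowerSeries.coeff_zero_eq_constantCoeff_apply, hQ]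
  simp only [ZeroMemClass.coe_zero, zero_mul, zero_add]
  refine IsUltrametricDist.norm_tsum_le_of_forall_le_of_nonneg (norm_nonneg x) fun k ↦
    (norm_coeff_mul_pow_le_one Q x (k + 1)).trans ?_
  exact pow_le_of_le_one (norm_nonneg _) hx.le (Nat.succ_ne_zero k)

/-- **Evaluation on the open disc is multiplicative** (Cauchy product of two absolutely convergent
series: `∑_{k+l=n} [T^k]P x^k · [T^l]Q x^l = [T^n](PQ) x^n`). [cite: Koblitz1984, Ch. IV §1] -/
theorem HasValueAt.mul {P Q : PowerSeries (PadicComplexInt p)} {x u w : ℂ_[p]} (hx : ‖x‖ < 1)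
    (hP : IntSeries.HasValueAt P x u) (hQ : IntSeries.HasValueAt Q x w) :
    IntSeries.HasValueAt (P * Q) x (u * w) := by
  have hPn := summable_norm_coeff_mul_pow P hx
  have hQn := summable_norm_coeff_mul_pow Q hx
  have hprod := tsum_mul_tsum_eq_tsum_sum_antidiagonal_of_summable_norm hPn hQn
  rw [hP.tsum_eq, hQ.tsum_eq] at hprod
  have key : ∀ n : ℕ, ∑ kl ∈ antidiagonal n,
      ((PowerSeries.coeff kl.1 P : PadicComplexInt p) : ℂ_[p]) * x ^ kl.1 *
        (((PowerSeries.coeff kl.2 Q : PadicComplexInt p) : ℂ_[p]) * x ^ kl.2) =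
      ((PowerSeries.coeff n (P * Q) : PadicComplexInt p) : ℂ_[p]) * x ^ n := by
    intro n
    rw [PowerSeries.coeff_mul, AddSubmonoidClass.coe_finsetSum, sum_mul]
    refine sum_congr rfl fun kl hkl ↦ ?_
    rw [HasAntidiagonal.mem_antidiagonal] at hkl
    rw [MulMemClass.coe_mul, ← hkl, pow_add]
    ring
  have hS := summable_sum_mul_antidiagonal_of_summable_norm' hPn hP.summable hQn hQ.summable
  have h2 := hS.hasSum
  rw [← hprod] at h2
  unfold IntSeries.HasValueAt
  simpa only [key] using h2

/-- Evaluation of powers: `P^i` has value `u^i` at `x` if `P` has value `u` (and `1` has value `1`).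
[cite: Koblitz1984, Ch. IV §1] -/
theorem HasValueAt.pow {P : PowerSeries (PadicComplexInt p)} {x u : ℂ_[p]} (hx : ‖x‖ < 1)
    (hP : IntSeries.HasValueAt P x u) (i : ℕ) : IntSeries.HasValueAt (P ^ i) x (u ^ i) := by
  induction i with
  | zero =>
    rw [pow_zero, pow_zero]
    have h := hasSum_single (f := fun k : ℕ ↦
      ((PowerSeries.coeff k (1 : PowerSeries (PadicComplexInt p)) : PadicComplexInt p) : ℂ_[p]) * x ^ k)
      0 (fun k hk ↦ by rw [PowerSeries.coeff_one, if_neg hk]; simp)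
    simpa [IntSeries.HasValueAt, PowerSeries.coeff_one] using h
  | succ i ih =>
    rw [pow_succ, pow_succ]
    exact ih.mul hx hP

variable (G : PowerSeries (PowerSeries (PadicComplexInt p))) {a₁ a₂ : PowerSeries (PadicComplexInt p)}

/-- The general term `[T₁^i T₂^j]G · [T^n](a₁^i a₂^j) · x^n` of the triple family behind
`hasValueAt_curveSubst_iff` (indexed by `((i, j), n)`). [cite: deShalit1987, II.4.17 (54) (p. 78)] -/
def curveTerm (a₁ a₂ : PowerSeries (PadicComplexInt p)) (x : ℂ_[p]) (q : (ℕ × ℕ) × ℕ) : ℂ_[p] :=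
  ((PowerSeries.coeff q.1.2 (PowerSeries.coeff q.1.1 G) : PadicComplexInt p) : ℂ_[p]) *
    ((PowerSeries.coeff q.2 (a₁ ^ q.1.1 * a₂ ^ q.1.2) : PadicComplexInt p) : ℂ_[p]) * x ^ q.2

/-- On its support `i + j ≤ n` the triple term is bounded by `‖x‖^n ≤ s^i s^j s^n`, `s = √‖x‖`; off the
support it vanishes. [cite: deShalit1987, II.4.17 (51)–(54) (p. 77–78)] -/
theorem norm_curveTerm_le (ha₁ : PowerSeries.constantCoeff a₁ = 0) (ha₂ : PowerSeries.constantCoeff a₂ = 0)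
    {x : ℂ_[p]} (hx : ‖x‖ < 1) (q : (ℕ × ℕ) × ℕ) :
    ‖curveTerm G a₁ a₂ x q‖ ≤ Real.sqrt ‖x‖ ^ q.1.1 * Real.sqrt ‖x‖ ^ q.1.2 * Real.sqrt ‖x‖ ^ q.2 := by
  obtain ⟨⟨i, j⟩, n⟩ := q
  set s : ℝ := Real.sqrt ‖x‖ with hs
  have hs0 : 0 ≤ s := Real.sqrt_nonneg _
  have hs1 : s ≤ 1 := by
    rw [hs, Real.sqrt_le_one]
    exact hx.le
  have hss : s * s = ‖x‖ := Real.mul_self_sqrt (norm_nonneg x)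
  by_cases hij : i + j ≤ n
  · -- `‖term‖ ≤ ‖x‖^n = s^(2n) ≤ s^(i+j+n)`
    have hle : ‖curveTerm G a₁ a₂ x ((i, j), n)‖ ≤ ‖x‖ ^ n := by
      rw [curveTerm, norm_mul, norm_mul, norm_pow]
      calc ‖((PowerSeries.coeff j (PowerSeries.coeff i G) : PadicComplexInt p) : ℂ_[p])‖ *
            ‖((PowerSeries.coeff n (a₁ ^ i * a₂ ^ j) : PadicComplexInt p) : ℂ_[p])‖ * ‖x‖ ^ n
          ≤ 1 * 1 * ‖x‖ ^ n := by
            gcongr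
            · exact norm_coe_padicComplexInt_le_one _
            · exact norm_coe_padicComplexInt_le_one _
        _ = ‖x‖ ^ n := by ring
    refine hle.trans ?_
    obtain ⟨m, rfl⟩ := Nat.exists_eq_add_of_le hij
    rw [show ‖x‖ ^ (i + j + m) = s ^ (i + j + m) * s ^ (i + j + m) by
      rw [← mul_pow, hss]]
    rw [show s ^ i * s ^ j * s ^ (i + j + m) = s ^ (i + j + m) * (s ^ i * s ^ j) by ring]
    gcongr s ^ (i + j + m) * ?_
    rw [← pow_add]
    exact pow_le_pow_of_le_one hs0 hs1 (by omega)
  · have h0 : curveTerm G a₁ a₂ x ((i, j), n) = 0 := by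
      rw [curveTerm, coeff_pow_mul_pow_eq_zero_of_lt ha₁ ha₂ (not_le.mp hij)]
      simp
    rw [h0, norm_zero]
    positivity

/-- The triple family is absolutely summable on the open disc. [cite: deShalit1987, II.4.17 (51)–(54) (p. 77–78)] -/
theorem summable_curveTerm (ha₁ : PowerSeries.constantCoeff a₁ = 0) (ha₂ : PowerSeries.constantCoeff a₂ = 0)
    {x : ℂ_[p]} (hx : ‖x‖ < 1) : Summable (curveTerm G a₁ a₂ x) := by
  set s : ℝ := Real.sqrt ‖x‖ with hs
  have hs0 : 0 ≤ s := Real.sqrt_nonneg _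
  have hs1 : s < 1 := by
    rw [hs, Real.sqrt_lt' one_pos, one_pow]
    exact hx
  have hg1 := summable_geometric_of_lt_one hs0 hs1
  have hg2 : Summable fun ij : ℕ × ℕ ↦ s ^ ij.1 * s ^ ij.2 :=
    hg1.mul_of_nonneg hg1 (fun _ ↦ pow_nonneg hs0 _) (fun _ ↦ pow_nonneg hs0 _)
  have hg3 : Summable fun q : (ℕ × ℕ) × ℕ ↦ s ^ q.1.1 * s ^ q.1.2 * s ^ q.2 :=
    hg2.mul_of_nonneg hg1 (fun _ ↦ mul_nonneg (pow_nonneg hs0 _) (pow_nonneg hs0 _))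
      (fun _ ↦ pow_nonneg hs0 _)
  exact hg3.of_norm_bounded (norm_curveTerm_le G ha₁ ha₂ hx)

/-- **Values of the restriction to a curve through the origin.** For `‖x‖ < 1` and `a₁, a₂` without
constant term, with values `y_i = a_i(x)`: `curveSubst a₁ a₂ G` has value `v` at `x` iff `G` has value
`v` at `(y₁, y₂)` — summing the absolutely convergent triple family `[T₁^iT₂^j]G · [T^n](a₁^ia₂^j) · x^n`
first over `n` (giving `[T₁^iT₂^j]G · y₁^i y₂^j`, evaluation being multiplicative) or first over
`(i, j)` (giving `[T^n](curveSubst) · x^n`, a finite sum). de Shalit's "(52) along a `ℤ_p`-line of (54)".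
[cite: deShalit1987, II.4.17 (51)–(54) (p. 77–78)] -/
theorem hasValueAt_curveSubst_iff (ha₁ : PowerSeries.constantCoeff a₁ = 0)
    (ha₂ : PowerSeries.constantCoeff a₂ = 0) {x : ℂ_[p]} (hx : ‖x‖ < 1) {y₁ y₂ : ℂ_[p]}
    (hy₁ : IntSeries.HasValueAt a₁ x y₁) (hy₂ : IntSeries.HasValueAt a₂ x y₂) (v : ℂ_[p]) :
    IntSeries.HasValueAt (curveSubst a₁ a₂ G) x v ↔ IntSeries.HasValueAt₂ G y₁ y₂ v := by
  have hS := summable_curveTerm G ha₁ ha₂ hx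
  set V : ℂ_[p] := ∑' q, curveTerm G a₁ a₂ x q with hV
  -- fibres over `(i, j)`: `∑_n = [T₁^iT₂^j]G · y₁^i y₂^j`
  have hfib₁ : ∀ ij : ℕ × ℕ, HasSum (fun n : ℕ ↦ curveTerm G a₁ a₂ x (ij, n))
      (((PowerSeries.coeff ij.2 (PowerSeries.coeff ij.1 G) : PadicComplexInt p) : ℂ_[p]) *
        y₁ ^ ij.1 * y₂ ^ ij.2) := by
    intro ij
    have h := ((hy₁.pow hx ij.1).mul hx (hy₂.pow hx ij.2)).mul_left
      (((PowerSeries.coeff ij.2 (PowerSeries.coeff ij.1 G) : PadicComplexInt p) : ℂ_[p]))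
    rw [← mul_assoc] at h
    simpa only [curveTerm, mul_assoc] using h
  have h₁ : HasSum (fun ij : ℕ × ℕ ↦
      ((PowerSeries.coeff ij.2 (PowerSeries.coeff ij.1 G) : PadicComplexInt p) : ℂ_[p]) *
        y₁ ^ ij.1 * y₂ ^ ij.2) V :=
    hS.hasSum.prod_fiberwise hfib₁
  -- fibres over `n`: `∑_{(i,j)} = [T^n](curveSubst) · x^n` (finite support `i, j ≤ n`)
  have hfib₂ : ∀ n : ℕ, HasSum (fun ij : ℕ × ℕ ↦ curveTerm G a₁ a₂ x (ij, n))
      (((PowerSeries.coeff n (curveSubst a₁ a₂ G) : PadicComplexInt p) : ℂ_[p]) * x ^ n) := by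
    intro n
    have hfin : ∀ ij ∉ range (n + 1) ×ˢ range (n + 1), curveTerm G a₁ a₂ x (ij, n) = 0 := by
      intro ij hij
      rw [mem_product, mem_range, mem_range, not_and_or, not_lt, not_lt] at hij
      have hlt : n < ij.1 + ij.2 := by omega
      rw [curveTerm, coeff_pow_mul_pow_eq_zero_of_lt ha₁ ha₂ hlt]
      simp
    have hsum : ∑ ij ∈ range (n + 1) ×ˢ range (n + 1), curveTerm G a₁ a₂ x (ij, n) =
        ((PowerSeries.coeff n (curveSubst a₁ a₂ G) : PadicComplexInt p) : ℂ_[p]) * x ^ n := by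
      rw [coeff_curveSubst, sum_product, AddSubmonoidClass.coe_finsetSum, sum_mul]
      refine sum_congr rfl fun i _ ↦ ?_
      rw [AddSubmonoidClass.coe_finsetSum, sum_mul]
      refine sum_congr rfl fun j _ ↦ ?_
      rw [curveTerm, MulMemClass.coe_mul]
    rw [← hsum]
    exact hasSum_sum_of_ne_finset_zero hfin
  have hS' : HasSum (fun q : ℕ × (ℕ × ℕ) ↦ curveTerm G a₁ a₂ x (q.2, q.1)) V :=
    ((Equiv.prodComm ℕ (ℕ × ℕ)).hasSum_iff (f := curveTerm G a₁ a₂ x) (a := V)).mpr hS.hasSum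
  have h₂ : HasSum (fun n : ℕ ↦
      ((PowerSeries.coeff n (curveSubst a₁ a₂ G) : PadicComplexInt p) : ℂ_[p]) * x ^ n) V :=
    hS'.prod_fiberwise hfib₂
  constructor
  · intro h
    rw [IntSeries.HasValueAt] at h
    rw [h.unique h₂]
    exact h₁
  · intro h
    rw [IntSeries.HasValueAt₂] at h
    rw [h.unique h₁]
    exact h₂
end Values

end IntSeries
end Literature.NumberTheory.EllipticCurves
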